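import Summits.AtomisticToContinuum.FouriersLaw.Theorems.BondHeatUncertaintySubdiffusiveBondHeatKernelDetailedBalanceLaplaceA

/-!
# Kernel detailed balance (H2), part B: the resolvent identity `B_λ(f, (λ - L)b) = ⟨f, b⟩_{μ_T}` and the static flip-adjointness

Support for the registered stub `stub_kernelDetailedBalance` (H2) of crux `stmt-AtomisticToContinuum-9120` (line
`bath-bond-deficit-integral`); continuation of part A (`…KernelDetailedBalanceLaplaceA`):

* `pinnedChain_integrableOn_exp_mul_act` — `t ↦ e^{-λt} P_{t⁺} g(z)` is integrable on `(0,∞)` for bounded continuous `g`;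
* `pinnedChain_lap_resolvent` — **`B_λ(f, λb - Lb) = ∫ f b dμ_T`** for `b ∈ C_c^∞` and bounded continuous `f` (Fubini and
  Dynkin's identity in resolvent form, `pinnedChain_resolvent_generator`);
* `pinnedChain_integral_generator_flip_mul` — **static generalised detailed balance** `∫ (L a)∘Θ · b dμ_T = ∫ a∘Θ · L b dμ_T`
  for test functions `a, b` (from `langevin_integral_gibbs_mul_generator`, Rey-Bellet 2006 Lemma 4.2 at equal temperatures).
-/

noncomputable section

open MeasureTheory ProbabilityTheory Filter Topology Set Function
open scoped NNReal ENNReal ContDiff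
open Literature.MathematicalPhysics.KineticTheory.HeatConduction
open Literature.MathematicalPhysics.KineticTheory OscillatorChain
open Summit.AtomisticToContinuum.FouriersLaw.Theorems.OddSectorIrreversibility
open Summit.AtomisticToContinuum.FouriersLaw.Cruxes.SuperadditiveResistance.FloatingProbeBypassLaplacian
  (contDiff_flip hasCompactSupport_flip)

namespace Summit.AtomisticToContinuum.FouriersLaw.Theorems.SubdiffusiveBondHeat

variable {N : ℕ}

section Pinned

variable {ω₂ lam β γ : ℝ} (hω : 0 < ω₂) (hl : 0 ≤ lam) (hβ : 0 < β) (hγ : 0 < γ) (hN : 0 < N)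
  {T : ℝ} (hT : 0 < T)
include hω hl hβ hγ hN hT

omit hN hT in
/-- For bounded continuous `g` and `λ > 0`, `t ↦ e^{-λt} P_{t⁺} g(z)` is integrable on `(0, ∞)`. [folklore] -/
theorem pinnedChain_integrableOn_exp_mul_act {g : PhaseSpace N → ℝ} (hg : Continuous g) {B : ℝ}
    (hB : ∀ y, ‖g y‖ ≤ B) {lam' : ℝ} (hlam : 0 < lam') (z : PhaseSpace N) :
    IntegrableOn (fun t : ℝ => Real.exp (-(lam' * t)) *
      ∫ y, g y ∂((pinnedChain ω₂ lam β γ).transitionKernel N T T t.toNNReal z)) (Ioi 0) := by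
  have h2 := (pinnedChain_stronglyMeasurable_act_uncurry hω hl hβ.le hγ.le T T (N := N) hg.measurable).comp_measurable
    (measurable_id.prodMk measurable_const : Measurable fun t : ℝ => (t, z))
  have hexpm : Continuous fun t : ℝ => Real.exp (-(lam' * t)) :=
    Real.continuous_exp.comp (continuous_const.mul continuous_id).neg
  refine Integrable.mono' ((exp_neg_integrableOn_Ioi 0 hlam).const_mul B)
    (hexpm.aestronglyMeasurable.mul h2.aestronglyMeasurable) ?_
  refine (ae_restrict_iff' measurableSet_Ioi).2 (Eventually.of_forall fun t _ => ?_)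
  rw [norm_mul, Real.norm_eq_abs, abs_of_pos (Real.exp_pos _), neg_mul, mul_comm B]
  exact mul_le_mul_of_nonneg_left (pinnedChain_abs_act_le_of_bounded hω hl hβ hγ hB _ z) (Real.exp_pos _).le

/-- **The resolvent identity for `B_λ`.** For `b ∈ C_c^∞`, bounded continuous `f` and `λ > 0`:
`∫₀^∞ e^{-λt} ⟨f, P_t(λb - Lb)⟩_{μ_T} dt = ⟨f, b⟩_{μ_T}` (Fubini, then `R_λ(λb - Lb) = b` pointwise).
[cite: CuneoEckmannHairerReyBellet2018, §3 p. 7] -/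
theorem pinnedChain_lap_resolvent {f b : PhaseSpace N → ℝ} (hf : Continuous f) {Bf : ℝ} (hBf : ∀ y, ‖f y‖ ≤ Bf)
    (hb : ContDiff ℝ ∞ b) (hbc : HasCompactSupport b) {lam' : ℝ} (hlam : 0 < lam') :
    ∫ t in Ioi (0 : ℝ), Real.exp (-(lam' * t)) * ∫ z, f z *
        (∫ y, (lam' * b y - (pinnedChain ω₂ lam β γ).generator N T T b y)
          ∂((pinnedChain ω₂ lam β γ).transitionKernel N T T t.toNNReal z)) ∂((pinnedChain ω₂ lam β γ).gibbsMeasure N T) =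
      ∫ z, f z * b z ∂((pinnedChain ω₂ lam β γ).gibbsMeasure N T) := by
  -- Dynkin's identity in resolvent form (for every starting point), smoothness and bounds
  have hres := pinnedChain_resolvent_generator hω hl hβ hγ hN hT hb hbc hlam
  haveI : IsProbabilityMeasure ((pinnedChain ω₂ lam β γ).gibbsMeasure N T) :=
    pinnedChain_isProbabilityMeasure_gibbsMeasure hω hl hβ.le γ N hT
  have hU1 : ContDiff ℝ 1 (pinnedChain ω₂ lam β γ).U := pinnedChain_contDiff_U ω₂ lam β γ
  have hV1 : ContDiff ℝ 1 (pinnedChain ω₂ lam β γ).V := pinnedChain_contDiff_V ω₂ lam β γ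
  have hb2 : ContDiff ℝ 2 b := hb.of_le (by norm_cast)
  have hLc : Continuous ((pinnedChain ω₂ lam β γ).generator N T T b) :=
    (pinnedChain ω₂ lam β γ).continuous_generator hU1 hV1 N T T hb2
  obtain ⟨Bb, hBb⟩ := hb.continuous.bounded_above_of_compact_support hbc
  obtain ⟨BL, hBL⟩ := hLc.bounded_above_of_compact_support
    ((pinnedChain ω₂ lam β γ).hasCompactSupport_generator N T T hb2 hbc)
  have iB := pinnedChain_integrableOn_exp_mul_act hω hl hβ hγ (T := T) hb.continuous hBb hlam
  have iL := pinnedChain_integrableOn_exp_mul_act hω hl hβ hγ (T := T) hLc hBL hlam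
  -- the observable `g = λ b - L b` is continuous and bounded
  have hgc : Continuous fun y => lam' * b y - (pinnedChain ω₂ lam β γ).generator N T T b y :=
    (continuous_const.mul hb.continuous).sub hLc
  have hgb : ∀ y, ‖lam' * b y - (pinnedChain ω₂ lam β γ).generator N T T b y‖ ≤ |lam'| * Bb + BL := fun y => by
    have h1 : ‖lam' * b y‖ ≤ |lam'| * Bb := by
      rw [norm_mul, Real.norm_eq_abs]
      exact mul_le_mul_of_nonneg_left (hBb y) (abs_nonneg _)
    exact (norm_sub_le _ _).trans (add_le_add h1 (hBL y))
  have hBf0 : 0 ≤ Bf := (norm_nonneg _).trans (hBf 0)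
  have hact := pinnedChain_stronglyMeasurable_act_uncurry hω hl hβ.le hγ.le T T (N := N) hgc.measurable
  -- abbreviations
  set P := pinnedChain ω₂ lam β γ with hP
  set μ := P.gibbsMeasure N T with hμ
  -- the integrand as a function of `(t, z)`; it is jointly measurable and integrable
  set F : ℝ → PhaseSpace N → ℝ := fun t z => Real.exp (-(lam' * t)) *
    (f z * ∫ y, (lam' * b y - P.generator N T T b y) ∂(P.transitionKernel N T T t.toNNReal z)) with hF
  have hFm : StronglyMeasurable (uncurry F) := by
    have e : uncurry F = fun q : ℝ × PhaseSpace N => Real.exp (-(lam' * q.1)) *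
        (f q.2 * ∫ y, (lam' * b y - P.generator N T T b y) ∂(P.transitionKernel N T T q.1.toNNReal q.2)) := by
      funext q; rfl
    rw [e]
    exact ((Real.continuous_exp.comp (continuous_const.mul continuous_fst).neg).stronglyMeasurable).mul
      ((hf.comp continuous_snd).stronglyMeasurable.mul hact)
  have hFint : Integrable (uncurry F) ((volume.restrict (Ioi (0 : ℝ))).prod μ) := by
    have h1 : Integrable (fun t : ℝ => Real.exp (-(lam' * t))) (volume.restrict (Ioi 0)) :=
      Integrable.congr (exp_neg_integrableOn_Ioi 0 hlam) (Eventually.of_forall fun t => by simp [neg_mul])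
    have hdom : Integrable (fun q : ℝ × PhaseSpace N => Real.exp (-(lam' * q.1)) * (Bf * (|lam'| * Bb + BL)))
        ((volume.restrict (Ioi (0 : ℝ))).prod μ) :=
      h1.mul_prod (integrable_const (Bf * (|lam'| * Bb + BL)))
    refine hdom.mono' hFm.aestronglyMeasurable (Eventually.of_forall fun q => ?_)
    show ‖F q.1 q.2‖ ≤ _
    simp only [hF]
    rw [norm_mul, Real.norm_eq_abs, abs_of_pos (Real.exp_pos _), norm_mul]
    refine mul_le_mul_of_nonneg_left ?_ (Real.exp_pos _).le
    exact mul_le_mul (hBf _) (pinnedChain_abs_act_le_of_bounded hω hl hβ hγ hgb _ _) (norm_nonneg _) hBf0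
  -- pull `e^{-λt}` inside and swap the integrals (Fubini)
  have hinside : ∀ t : ℝ, Real.exp (-(lam' * t)) * ∫ z, f z *
      (∫ y, (lam' * b y - P.generator N T T b y) ∂(P.transitionKernel N T T t.toNNReal z)) ∂μ = ∫ z, F t z ∂μ :=
    fun t => by simp only [hF]; exact (integral_const_mul _ _).symm
  -- pointwise in `z`, the inner `t`-integral is `f z * b z`
  have hsplit : ∀ (t : ℝ) (z : PhaseSpace N),
      ∫ y, (lam' * b y - P.generator N T T b y) ∂(P.transitionKernel N T T t.toNNReal z) =
        lam' * (∫ y, b y ∂(P.transitionKernel N T T t.toNNReal z)) -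
          ∫ y, P.generator N T T b y ∂(P.transitionKernel N T T t.toNNReal z) := by
    intro t z
    haveI := pinnedChain_isMarkovKernel_transitionKernel hω hl hβ.le hγ.le N T T t.toNNReal
    have i₁ : Integrable b (P.transitionKernel N T T t.toNNReal z) :=
      (integrable_const Bb).mono' hb.continuous.aestronglyMeasurable (Eventually.of_forall hBb)
    have i₂ : Integrable (P.generator N T T b) (P.transitionKernel N T T t.toNNReal z) :=
      (integrable_const BL).mono' hLc.aestronglyMeasurable (Eventually.of_forall hBL)
    rw [integral_sub (i₁.const_mul lam') i₂, integral_const_mul]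
  have hinner : ∀ z : PhaseSpace N, (∫ t in Ioi (0 : ℝ), F t z) = f z * b z := by
    intro z
    simp only [hF]
    calc ∫ t in Ioi (0 : ℝ), Real.exp (-(lam' * t)) * (f z *
            ∫ y, (lam' * b y - P.generator N T T b y) ∂(P.transitionKernel N T T t.toNNReal z))
        = ∫ t in Ioi (0 : ℝ), f z * (lam' * (Real.exp (-(lam' * t)) *
              ∫ y, b y ∂(P.transitionKernel N T T t.toNNReal z)) -
            Real.exp (-(lam' * t)) * ∫ y, P.generator N T T b y ∂(P.transitionKernel N T T t.toNNReal z)) := by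
          refine integral_congr_ae (Eventually.of_forall fun t => ?_)
          beta_reduce
          rw [hsplit t z]
          ring
      _ = f z * (lam' * (∫ t in Ioi (0 : ℝ), Real.exp (-(lam' * t)) *
              ∫ y, b y ∂(P.transitionKernel N T T t.toNNReal z)) -
            ∫ t in Ioi (0 : ℝ), Real.exp (-(lam' * t)) *
              ∫ y, P.generator N T T b y ∂(P.transitionKernel N T T t.toNNReal z)) := by
          rw [integral_const_mul, integral_sub ((iB z).const_mul lam') (iL z), integral_const_mul]
      _ = f z * b z := by rw [hres z]; ring
  calc ∫ t in Ioi (0 : ℝ), Real.exp (-(lam' * t)) * ∫ z, f z *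
          (∫ y, (lam' * b y - P.generator N T T b y) ∂(P.transitionKernel N T T t.toNNReal z)) ∂μ
      = ∫ t in Ioi (0 : ℝ), ∫ z, F t z ∂μ := integral_congr_ae (Eventually.of_forall hinside)
    _ = ∫ z, (∫ t in Ioi (0 : ℝ), F t z) ∂μ := integral_integral_swap hFint
    _ = ∫ z, f z * b z ∂μ := integral_congr_ae (Eventually.of_forall hinner)

omit hω hl hβ in
/-- **Static generalised detailed balance** for the pinned chain at temperature `T`:
`∫ (L a)(Θz) b(z) dμ_T = ∫ a(Θz) (L b)(z) dμ_T` for test functions `a, b` — the `μ_T`-adjoint of `L` on `C_c^∞` is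
`a ↦ (L(a∘Θ))∘Θ` (`langevin_integral_gibbs_mul_generator`, divided by the partition function).
[cite: ReyBellet2006, Lemma 4.2] -/
theorem pinnedChain_integral_generator_flip_mul {a b : PhaseSpace N → ℝ} (ha : ContDiff ℝ ∞ a)
    (hac : HasCompactSupport a) (hb : ContDiff ℝ ∞ b) :
    ∫ z, (pinnedChain ω₂ lam β γ).generator N T T a (z.1, -z.2) * b z ∂((pinnedChain ω₂ lam β γ).gibbsMeasure N T) =
      ∫ z, a (z.1, -z.2) * (pinnedChain ω₂ lam β γ).generator N T T b z ∂((pinnedChain ω₂ lam β γ).gibbsMeasure N T) := by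
  set P := pinnedChain ω₂ lam β γ with hP
  have hU : ContDiff ℝ ∞ P.U := pinnedChain_contDiff_U ω₂ lam β γ
  have hV : ContDiff ℝ ∞ P.V := pinnedChain_contDiff_V ω₂ lam β γ
  have hγ' : 0 ≤ P.γ := hγ.le
  -- the volume identity with `g₁ = a∘Θ`, `g₂ = b`
  have key := langevin_integral_gibbs_mul_generator P hU hV hN hγ' hT (contDiff_flip ha)
    (hasCompactSupport_flip hac) hb
  rw [comp_flip_flip] at key
  -- `∫ F dμ_T = ∫ (ρ/Z) F dx`
  have htilt : ∀ F : PhaseSpace N → ℝ, ∫ z, F z ∂(P.gibbsMeasure N T) =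
      ∫ z, (P.gibbsDensity N T z / ∫ x, P.gibbsDensity N T x) * F z := by
    intro F
    rw [OscillatorChain.gibbsMeasure_eq, integral_tilted]
    rfl
  rw [htilt, htilt]
  have e1 : (fun z => P.gibbsDensity N T z / (∫ x, P.gibbsDensity N T x) * (P.generator N T T a (z.1, -z.2) * b z)) =
      fun z => (∫ x, P.gibbsDensity N T x)⁻¹ * (P.gibbsDensity N T z * P.generator N T T a (z.1, -z.2) * b z) := by
    funext z; ring
  have e2 : (fun z => P.gibbsDensity N T z / (∫ x, P.gibbsDensity N T x) * (a (z.1, -z.2) * P.generator N T T b z)) =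
      fun z => (∫ x, P.gibbsDensity N T x)⁻¹ * (P.gibbsDensity N T z * a (z.1, -z.2) * P.generator N T T b z) := by
    funext z; ring
  rw [e1, e2, integral_const_mul, integral_const_mul, key]

end Pinned

/-- Registered anchor `helper_laplaceResolvent` of this file (= `pinnedChain_lap_resolvent` in closed form): the resolvent identity
`B_λ(f, λb - Lb) = ⟨f, b⟩_{μ_T}`. [cite: CuneoEckmannHairerReyBellet2018, §3 p. 7] -/
theorem helper_laplaceResolvent : ∀ ω₂ lam β γ : ℝ, 0 < ω₂ → 0 ≤ lam → 0 < β → 0 < γ → ∀ (N : ℕ), 0 < N → ∀ T : ℝ, 0 < T → ∀ (f b : PhaseSpace N → ℝ), Continuous f → ∀ Bf : ℝ, (∀ y, ‖f y‖ ≤ Bf) → ContDiff ℝ ((⊤ : ℕ∞) : WithTop ℕ∞) b → HasCompactSupport b → ∀ lam' : ℝ, 0 < lam' → ∫ t in Set.Ioi (0 : ℝ), Real.exp (-(lam' * t)) * ∫ z, f z * (∫ y, (lam' * b y - (pinnedChain ω₂ lam β γ).generator N T T b y) ∂((pinnedChain ω₂ lam β γ).transitionKernel N T T t.toNNReal z))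 ∂((pinnedChain ω₂ lam β γ).gibbsMeasure N T) = ∫ z, f z * b z ∂((pinnedChain ω₂ lam β γ).gibbsMeasure N T) :=
  fun _ _ _ _ hω hl hβ hγ _ hN _ hT _ _ hf _ hBf hb hbc _ hlam =>
    pinnedChain_lap_resolvent hω hl hβ hγ hN hT hf hBf hb hbc hlam

end Summit.AtomisticToContinuum.FouriersLaw.Theorems.SubdiffusiveBondHeat
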